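import Mathlib.Geometry.Manifold.PartitionOfUnity
import Mathlib.Geometry.Manifold.Algebra.LieGroup
import Literature.Topology.FourManifolds.HalfDiscFromCollar
import Literature.Topology.FourManifolds.ConnectedSumData
import HarnessLib

/-!
# Half-discs with prescribed flat face inside a boundary chart (no collar needed)

Topic `Literature/Topology/FourManifolds`. The named fact `Literature.Topology.FourManifolds.exists_halfDisc_face_eq`
(`CorkDecompositionSplitting.lean`) asks, for *every* disc `f : ℝⁿ⁺¹ ↪ ∂A` of the boundary of a
smooth manifold with boundary `A`, for a half-disc `k : ℝⁿ⁺²₊ ↪ A` with flat face `f`; in that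
generality it rests on the collaring theorem (`HalfDiscFromCollar.lean`). Matveyev's argument only
ever needs half-discs on *small* discs, and for a disc whose image lies in the domain of one
boundary chart the half-disc can be written down from the chart. This file proves that local
statement, with no appeal to collars:

* `Literature.Topology.FourManifolds.exists_halfDisc_face_eq_of_subset_source`: if `e` is a chart of the atlas of `A` and
  `b.incl (f x') ∈ e.source` for all `x'`, then there is a smooth embedding
  `k : EuclideanHalfSpace (n + 2) → A` with open range and `k (0, x') = b.incl (f x')`;
* `Literature.Topology.FourManifolds.BoundaryData.exists_disc_subset`: every neighbourhood of a point `z₀ ∈ ∂A` contains the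
  (open) range of a disc `f : ℝⁿ⁺¹ ↪ ∂A` through `z₀` (the inverse of a chart of `∂A` onto `ℝⁿ⁺¹`
  with small source; cf. the tree's `exists_mem_maximalAtlas_target_eq_univ`).

**Construction.** Read the disc in the chart: `g x' := tail (e (b.incl (f x')))`, so that
`e (b.incl (f x')) = (0, g x')` (`toHalfSpace_tail_chart`: charts map `∂A` into the hyperplane
`{x₀ = 0}`). Then `g : ℝⁿ⁺¹ → ℝⁿ⁺¹` is smooth, injective and open (§2; its inverse
`f⁻¹ ∘ incl⁻¹ ∘ e⁻¹ ∘ (0, ·)` is smooth on the open range of `g`, by the tree's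
`contMDiffOn_leftInverse_of_isImmersion`). By a smooth-partition-of-unity lemma of Mathlib
(`Metric.exists_contMDiffMap_forall_closedBall_subset` on `ℝⁿ⁺¹ × ℝ`) there is a smooth
`δ : ℝⁿ⁺¹ → (0, ∞)` with the vertical segments `{(t, g x') | 0 ≤ t ≤ δ x'}` inside `e.target`
(§3). Put `Ψ (x₀, x') := (δ(x') σ(x₀), g x')` with the squashing diffeomorphism
`σ : [0, ∞) ≅ [0, 1/2)` of `HalfDiscFromCollar.lean`, a smooth embedding of the closed half space
onto an open subset of `e.target` with explicit smooth inverse, and `k := e.symm ∘ Ψ` (§4). Then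
`k (0, x') = e.symm (0, g x') = b.incl (f x')`, `k` is an open topological embedding, `k` and
`k⁻¹ = Ψ⁻¹ ∘ e` are smooth, and the chart criterion
`Literature.Topology.FourManifolds.isSmoothEmbedding_of_symm_trans_chartAt_mem_maximalAtlas` applies.

## References

* M. W. Hirsch, *Differential Topology*, GTM 33 (1976), §4.6 (collars and half-discs).
* A. A. Kosinski, *Differential Manifolds* (1993), Ch. VI §5 (boundary connected sum).
* J. M. Lee, *Introduction to Smooth Manifolds*, 2nd ed. (2013), Thm. 1.46 (boundary charts).

## Design notes

* Everything is in namespace `Literature`; no named facts are introduced; `σ`, `τ` are the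
  `collarSquash`/`collarUnsquash` of `HalfDiscFromCollar.lean`, and the splitting `ℝⁿ⁺¹ × ℝ ≅ ℝⁿ⁺²`
  is the tree's `BoundaryManifold.consCLE`/`tail`/`toHalfSpace` (`Cobordism.lean`).
-/

open scoped Manifold ContDiff Topology
open Set Function Topology OpenPartialHomeomorph

noncomputable section

namespace Literature.Topology.FourManifolds

universe u

/-- Local notation: `𝔼 n` is the model Euclidean space `EuclideanSpace ℝ (Fin n)`. -/
local notation "𝔼 " n:arg => EuclideanSpace ℝ (Fin n)

/-! ### §1 Charts onto the whole model space with small source; small discs in `∂A` -/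

section SmallCharts

variable {m : ℕ} {M : Type u} [TopologicalSpace M] [ChartedSpace (𝔼 m) M] [IsManifold (𝓡 m) ∞ M]

/-- Every neighbourhood `U` of a point `x` of a smooth manifold modelled on `ℝᵐ` contains the
source of a chart of the maximal smooth atlas at `x` whose target is all of `ℝᵐ` (shrink the
preferred chart to a small ball around the image of `x` and compose with `ball ≅ ℝᵐ`; cf. the
tree's `exists_mem_maximalAtlas_target_eq_univ`). [folklore] -/
theorem exists_mem_maximalAtlas_target_eq_univ_source_subset (x : M) {U : Set M} (hU : U ∈ 𝓝 x) :
    ∃ e ∈ IsManifold.maximalAtlas (𝓡 m) ∞ M, x ∈ e.source ∧ e.source ⊆ U ∧ e.target = univ := by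
  obtain ⟨U', hU'U, hU'o, hxU'⟩ := mem_nhds_iff.1 hU
  set e₀ := chartAt (𝔼 m) x
  have hV : IsOpen (e₀.target ∩ e₀.symm ⁻¹' U') := e₀.isOpen_inter_preimage_symm hU'o
  have hxV : e₀ x ∈ e₀.target ∩ e₀.symm ⁻¹' U' :=
    ⟨mem_chart_target _ x, by rw [mem_preimage, e₀.left_inv (mem_chart_source _ x)]; exact hxU'⟩
  obtain ⟨r, hr, hball⟩ := Metric.isOpen_iff.1 hV (e₀ x) hxV
  set u := univBall (e₀ x) r
  have hut : u.target = Metric.ball (e₀ x) r := univBall_target _ hr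
  have h₀ := IsManifold.chart_mem_maximalAtlas (I := 𝓡 m) (n := ∞) x
  refine ⟨e₀ ≫ₕ u.symm, ?_, ?_, ?_, ?_⟩
  · apply OpenPartialHomeomorph.mem_maximalAtlas_of_contMDiffOn
    · rw [trans_source, coe_trans, symm_source, hut]
      exact contDiffOn_univBall_symm.contMDiffOn.comp
        ((contMDiffOn_of_mem_maximalAtlas h₀).mono inter_subset_left) fun y hy => hy.2
    · rw [trans_symm_eq_symm_trans_symm, symm_symm]
      exact (contMDiffOn_symm_of_mem_maximalAtlas h₀).comp contDiff_univBall.contMDiff.contMDiffOn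
        fun y hy => hy.2
  · simp only [trans_source, symm_source, hut, mem_inter_iff, mem_chart_source, mem_preimage,
      Metric.mem_ball_self hr, and_self, e₀]
  · intro y hy
    rw [trans_source, symm_source, hut] at hy
    have hy' : e₀ y ∈ e₀.target ∩ e₀.symm ⁻¹' U' := hball hy.2
    have := hy'.2
    rw [mem_preimage, e₀.left_inv hy.1] at this
    exact hU'U this
  · rw [trans_target, symm_target, univBall_source, univ_inter, eq_univ_iff_forall]
    intro y
    exact (hball (hut ▸ u.map_source (by simp [u]))).1

end SmallCharts

section SmallDiscs

variable {n : ℕ} {A : Type u} [TopologicalSpace A] [ChartedSpace (EuclideanHalfSpace (n + 2)) A]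

/-- **Small discs in the boundary**: every neighbourhood `O` of a point `z₀` of the boundary
manifold `∂A` (a boundary datum `b`, modelled on `ℝⁿ⁺¹`) contains the range of a disc
`f : ℝⁿ⁺¹ ↪ ∂A` — a smooth embedding with open range — through `z₀`. [folklore] -/
theorem BoundaryData.exists_disc_subset (b : BoundaryData (𝓡∂ (n + 2)) A (𝓡 (n + 1)))
    (z₀ : b.carrier) {O : Set b.carrier} (hO : O ∈ 𝓝 z₀) :
    ∃ f : 𝔼 (n + 1) → b.carrier, Manifold.IsSmoothEmbedding (𝓡 (n + 1)) (𝓡 (n + 1)) ∞ f ∧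
      IsOpen (range f) ∧ range f ⊆ O ∧ z₀ ∈ range f := by
  obtain ⟨c, hc, hz₀, hcO, hct⟩ :=
    exists_mem_maximalAtlas_target_eq_univ_source_subset (m := n + 1) z₀ hO
  have hrange : range (⇑c.symm : 𝔼 (n + 1) → b.carrier) = c.source := by
    rw [← image_univ, ← hct, c.symm_image_target_eq_source]
  refine ⟨c.symm, isSmoothEmbedding_symm_of_target_eq_univ hc hct, ?_, ?_, ?_⟩
  · rw [hrange]; exact c.open_source
  · rw [hrange]; exact hcO
  · rw [hrange]; exact hz₀

end SmallDiscs

/-! ### §2 A disc of `∂A` read in a boundary chart -/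

section ChartFace

variable {n : ℕ} {A : Type u} [TopologicalSpace A] [ChartedSpace (EuclideanHalfSpace (n + 2)) A]
  {b : BoundaryData (𝓡∂ (n + 2)) A (𝓡 (n + 1))}

/-- The tail `(v 1, …, v (n+1)) ∈ ℝⁿ⁺¹` of a point of the closed half space (the tree's
`BoundaryManifold.tail` of the underlying vector). [folklore] -/
def hsTail (v : EuclideanHalfSpace (n + 2)) : 𝔼 (n + 1) := BoundaryManifold.tail (n + 1) v.val

/-- The tail is continuous. [folklore] -/
theorem continuous_hsTail : Continuous (hsTail (n := n)) :=
  (BoundaryManifold.continuous_tail (n + 1)).comp continuous_subtype_val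

/-- The tail is smooth (`𝓡∂ (n + 2)` to `𝓡 (n + 1)`). [folklore] -/
theorem contMDiff_hsTail : ContMDiff (𝓡∂ (n + 2)) (𝓡 (n + 1)) ∞ (hsTail (n := n)) :=
  (BoundaryManifold.contDiff_tail (n + 1)).contMDiff.comp (𝓡∂ (n + 2)).contMDiff

/-- The tail of the face point `(0, x')` is `x'`. [folklore] -/
@[simp] theorem hsTail_face (x' : 𝔼 (n + 1)) : hsTail (EuclideanHalfSpace.face x') = x' :=
  tail_val_face x'

/-- `toHalfSpace` is the model-with-boundary inverse of `u ↦ (0, u)`: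
`toHalfSpace u = (𝓡∂).symm (consCLE (u, 0))`, hence smooth. [folklore] -/
theorem contMDiff_toHalfSpace :
    ContMDiff (𝓡 (n + 1)) (𝓡∂ (n + 2)) ∞ (BoundaryManifold.toHalfSpace (n + 1)) := by
  have h : ContMDiff (𝓡 (n + 1)) (𝓡∂ (n + 2)) ∞ fun u : 𝔼 (n + 1) =>
      (𝓡∂ (n + 2)).symm (BoundaryManifold.consCLE (n + 1) (u, 0)) :=
    (𝓡∂ (n + 2)).contMDiffOn_symm.comp_contMDiff
      (BoundaryManifold.contDiff_consCLE_zero (n + 1)).contMDiff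
      fun u => consCLE_mem_range_modelWithCorners u le_rfl
  refine h.congr fun u => ?_
  exact (BoundaryManifold.modelWithCorners_symm_consCLE (n + 1) u).symm

variable (e : OpenPartialHomeomorph A (EuclideanHalfSpace (n + 2))) (f : 𝔼 (n + 1) → b.carrier)

/-- **The disc read in the chart**: `g x' := tail (e (b.incl (f x')))`. [folklore] -/
def chartFace (x' : 𝔼 (n + 1)) : 𝔼 (n + 1) := hsTail (e (b.incl (f x')))

/-- A left inverse `f⁻¹ ∘ incl⁻¹ ∘ e⁻¹ ∘ (0, ·)` of the disc read in the chart (`∂A` is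
nonempty, `f 0` being a point of it, so the junk inverses exist). [folklore] -/
def chartFaceInv (y : 𝔼 (n + 1)) : 𝔼 (n + 1) :=
  haveI : Nonempty b.carrier := ⟨f 0⟩
  invFun f (invFun b.incl (e.symm (BoundaryManifold.toHalfSpace (n + 1) y)))

variable {e f} [IsManifold (𝓡∂ (n + 2)) ∞ A] (he : e ∈ atlas (EuclideanHalfSpace (n + 2)) A)
  (hsub : ∀ x', b.incl (f x') ∈ e.source)
include he hsub

/-- In the chart the disc point `b.incl (f x')` reads `(0, g x')`. [cite: LeeSmoothManifolds2013, Thm. 1.46] -/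
theorem toHalfSpace_chartFace (x' : 𝔼 (n + 1)) :
    BoundaryManifold.toHalfSpace (n + 1) (chartFace e f x') = e (b.incl (f x')) :=
  BoundaryManifold.toHalfSpace_tail_chart he (hsub x') (b.incl_mem_boundary _)

/-- `e.symm (0, g x') = b.incl (f x')`. [folklore] -/
theorem symm_toHalfSpace_chartFace (x' : 𝔼 (n + 1)) :
    e.symm (BoundaryManifold.toHalfSpace (n + 1) (chartFace e f x')) = b.incl (f x') := by
  rw [toHalfSpace_chartFace he hsub, e.left_inv (hsub x')]

/-- `(0, g x') ∈ e.target`. [folklore] -/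
theorem toHalfSpace_chartFace_mem_target (x' : 𝔼 (n + 1)) :
    BoundaryManifold.toHalfSpace (n + 1) (chartFace e f x') ∈ e.target := by
  rw [toHalfSpace_chartFace he hsub]
  exact e.map_source (hsub x')

/-- The disc read in the chart is smooth, for `f` smooth. [folklore] -/
theorem contMDiff_chartFace (hf : ContMDiff (𝓡 (n + 1)) (𝓡 (n + 1)) ∞ f) :
    ContMDiff (𝓡 (n + 1)) (𝓡 (n + 1)) ∞ (chartFace e f) := by
  have h1 : ContMDiff (𝓡 (n + 1)) (𝓡∂ (n + 2)) ∞ fun x' => e (b.incl (f x')) :=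
    (contMDiffOn_of_mem_maximalAtlas (IsManifold.subset_maximalAtlas he)).comp_contMDiff
      (b.isSmoothEmbedding.contMDiff.comp hf) hsub
  exact contMDiff_hsTail.comp h1

/-- `g⁻¹ ∘ g = id` for `f` injective. [folklore] -/
@[simp] theorem chartFaceInv_chartFace (hf : Injective f) (x' : 𝔼 (n + 1)) :
    chartFaceInv e f (chartFace e f x') = x' := by
  haveI : Nonempty b.carrier := ⟨f 0⟩
  rw [chartFaceInv, symm_toHalfSpace_chartFace he hsub]
  exact (congrArg (invFun f) (leftInverse_invFun b.injective_incl (f x'))).trans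
    (leftInverse_invFun hf x')

/-- The disc read in the chart is injective, for `f` injective. [folklore] -/
theorem injective_chartFace (hf : Injective f) : Injective (chartFace e f) :=
  (LeftInverse.injective fun x' => chartFaceInv_chartFace he hsub hf x')

/-- **The inverse of the disc read in the chart is smooth on its range** (`f⁻¹`, `incl⁻¹` by the
tree's `contMDiffOn_leftInverse_of_isImmersion`, `e⁻¹` a chart, `(0, ·)` smooth). [folklore] -/
theorem contMDiffOn_chartFaceInv (hf : Manifold.IsSmoothEmbedding (𝓡 (n + 1)) (𝓡 (n + 1)) ∞ f) :
    ContMDiffOn (𝓡 (n + 1)) (𝓡 (n + 1)) ∞ (chartFaceInv e f) (range (chartFace e f)) := by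
  haveI : Nonempty b.carrier := ⟨f 0⟩
  have h1 : ContMDiffOn (𝓡 (n + 1)) (𝓡∂ (n + 2)) ∞
      (fun y => e.symm (BoundaryManifold.toHalfSpace (n + 1) y)) (range (chartFace e f)) :=
    (contMDiffOn_symm_of_mem_maximalAtlas (IsManifold.subset_maximalAtlas he)).comp
      contMDiff_toHalfSpace.contMDiffOn (by
        rintro _ ⟨x', rfl⟩; exact toHalfSpace_chartFace_mem_target he hsub x')
  have h2 : ContMDiffOn (𝓡 (n + 1)) (𝓡 (n + 1)) ∞
      (fun y => invFun b.incl (e.symm (BoundaryManifold.toHalfSpace (n + 1) y)))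
      (range (chartFace e f)) :=
    (contMDiffOn_leftInverse_of_isImmersion b.isSmoothEmbedding.isImmersion
      b.isSmoothEmbedding.isEmbedding (leftInverse_invFun b.injective_incl)).comp h1 (by
        rintro _ ⟨x', rfl⟩
        show e.symm (BoundaryManifold.toHalfSpace (n + 1) (chartFace e f x')) ∈ range b.incl
        rw [symm_toHalfSpace_chartFace he hsub]; exact mem_range_self _)
  exact (contMDiffOn_leftInverse_of_isImmersion hf.isImmersion hf.isEmbedding
    (leftInverse_invFun hf.isEmbedding.injective)).comp h2 (by
      rintro _ ⟨x', rfl⟩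
      show invFun b.incl (e.symm (BoundaryManifold.toHalfSpace (n + 1) (chartFace e f x'))) ∈ range f
      rw [symm_toHalfSpace_chartFace he hsub, leftInverse_invFun b.injective_incl]
      exact mem_range_self _)

/-- **The disc read in the chart is an open map**: for `O ⊆ ℝⁿ⁺¹` open, `f O` is open in `∂A`,
`incl (f O) = V ∩ ∂A` for an open `V ⊆ e.source`, and `tail (e (V ∩ ∂A)) = (0, ·)⁻¹ (e V)` is
open. [folklore] -/
theorem isOpen_image_chartFace (hf : Manifold.IsSmoothEmbedding (𝓡 (n + 1)) (𝓡 (n + 1)) ∞ f)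
    (hfo : IsOpen (range f)) {O : Set (𝔼 (n + 1))} (hO : IsOpen O) :
    IsOpen (chartFace e f '' O) := by
  -- `f '' O` is open in `∂A`, hence `incl '' (f '' O) = V ∩ range incl` with `V ⊆ e.source` open
  have hfO : IsOpen (f '' O) := (IsOpenEmbedding.mk hf.isEmbedding hfo).isOpenMap O hO
  obtain ⟨V, hV, hVf⟩ := b.isSmoothEmbedding.isEmbedding.isInducing.isOpen_iff.1 hfO
  set V' := V ∩ e.source with hV'
  have hV'o : IsOpen V' := hV.inter e.open_source
  have himg : b.incl '' (f '' O) = V' ∩ range b.incl := by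
    apply Subset.antisymm
    · rintro _ ⟨z, hz, rfl⟩
      obtain ⟨x', hx', rfl⟩ := hz
      refine ⟨⟨?_, hsub x'⟩, mem_range_self _⟩
      have : f x' ∈ b.incl ⁻¹' V := by rw [hVf]; exact ⟨x', hx', rfl⟩
      exact this
    · rintro _ ⟨⟨hzV, -⟩, z, rfl⟩
      have : z ∈ f '' O := by rw [← hVf]; exact hzV
      exact mem_image_of_mem _ this
  -- `chartFace '' O = (0, ·)⁻¹' (e '' V')`
  have hset : chartFace e f '' O = BoundaryManifold.toHalfSpace (n + 1) ⁻¹' (e '' V') := by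
    have h1 : chartFace e f '' O = hsTail '' (e '' (b.incl '' (f '' O))) := by
      simp only [chartFace, image_image]
    rw [h1, himg]
    apply Subset.antisymm
    · rintro _ ⟨w, ⟨z, ⟨hzV, hzb⟩, rfl⟩, rfl⟩
      refine ⟨z, hzV, ?_⟩
      rw [b.range_incl] at hzb
      exact (BoundaryManifold.toHalfSpace_tail_chart he hzV.2 hzb).symm
    · rintro y ⟨z, hzV, hzy⟩
      have hzt : BoundaryManifold.toHalfSpace (n + 1) y ∈ e.target := hzy ▸ e.map_source hzV.2
      have hzb : z ∈ range b.incl := by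
        rw [b.range_incl, ← e.left_inv hzV.2, hzy]
        exact BoundaryManifold.symm_toHalfSpace_mem_boundary he hzt
      refine ⟨e z, ⟨z, ⟨hzV, hzb⟩, rfl⟩, ?_⟩
      rw [hzy]
      show BoundaryManifold.tail (n + 1) (BoundaryManifold.toHalfSpace (n + 1) y).val = y
      rw [BoundaryManifold.toHalfSpace_val, BoundaryManifold.tail_consCLE]
  rw [hset]
  exact (e.isOpen_image_of_subset_source hV'o inter_subset_right).preimage
    (BoundaryManifold.continuous_toHalfSpace (n + 1))

/-- The disc read in the chart has open range. [folklore] -/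
theorem isOpen_range_chartFace (hf : Manifold.IsSmoothEmbedding (𝓡 (n + 1)) (𝓡 (n + 1)) ∞ f)
    (hfo : IsOpen (range f)) : IsOpen (range (chartFace e f)) := by
  rw [← image_univ]
  exact isOpen_image_chartFace he hsub hf hfo isOpen_univ

end ChartFace

/-! ### §3 A smooth positive height function with vertical segments inside the chart target -/

section Height

variable {n : ℕ} {A : Type u} [TopologicalSpace A] [ChartedSpace (EuclideanHalfSpace (n + 2)) A]
  {b : BoundaryData (𝓡∂ (n + 2)) A (𝓡 (n + 1))}
  {e : OpenPartialHomeomorph A (EuclideanHalfSpace (n + 2))} {f : 𝔼 (n + 1) → b.carrier}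

/-- The point `(t, y)` of the closed half space (`t ≥ 0` intended; `max t 0` is used).
[folklore] -/
def vertPt (y : 𝔼 (n + 1)) (t : ℝ) : EuclideanHalfSpace (n + 2) :=
  (𝓡∂ (n + 2)).symm (BoundaryManifold.consCLE (n + 1) (y, max t 0))

/-- The underlying vector of `vertPt y t` is `consCLE (y, t)` for `t ≥ 0`. [folklore] -/
theorem val_vertPt {y : 𝔼 (n + 1)} {t : ℝ} (ht : 0 ≤ t) :
    (vertPt y t).val = BoundaryManifold.consCLE (n + 1) (y, t) := by
  rw [vertPt, max_eq_left ht]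
  exact (𝓡∂ (n + 2)).right_inv (consCLE_mem_range_modelWithCorners y ht)

/-- `vertPt y 0 = (0, y)`. [folklore] -/
theorem vertPt_zero (y : 𝔼 (n + 1)) : vertPt y 0 = BoundaryManifold.toHalfSpace (n + 1) y := by
  rw [vertPt, max_self]
  exact BoundaryManifold.modelWithCorners_symm_consCLE (n + 1) y

/-- `(y, t) ↦ vertPt y t` is continuous. [folklore] -/
theorem continuous_vertPt : Continuous fun p : 𝔼 (n + 1) × ℝ => vertPt (n := n) p.1 p.2 :=
  (𝓡∂ (n + 2)).continuous_symm.comp ((BoundaryManifold.consCLE (n + 1)).continuous.comp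
    (continuous_fst.prodMk (continuous_snd.max continuous_const)))

/-- **A smooth positive height function**: if the face points `(0, g x')` of a continuous
`g : ℝⁿ⁺¹ → ℝⁿ⁺¹` lie in an open set `T` of the closed half space, there is a smooth
`δ : ℝⁿ⁺¹ → (0, ∞)` with `(t, g x') ∈ T` for `0 ≤ t ≤ δ x'` (Mathlib's
`Metric.exists_contMDiffMap_forall_closedBall_subset` on `ℝⁿ⁺¹ × ℝ`, for the closed set
`ℝⁿ⁺¹ × {0}` inside the open set `{(x', t) | (max t 0, g x') ∈ T}`). [folklore] -/
theorem exists_contDiff_pos_vertPt_mem {g : 𝔼 (n + 1) → 𝔼 (n + 1)} (hg : Continuous g)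
    {T : Set (EuclideanHalfSpace (n + 2))} (hT : IsOpen T)
    (h0 : ∀ x', BoundaryManifold.toHalfSpace (n + 1) (g x') ∈ T) :
    ∃ δ : 𝔼 (n + 1) → ℝ, ContDiff ℝ ∞ δ ∧ (∀ x', 0 < δ x') ∧
      ∀ x' (t : ℝ), 0 ≤ t → t ≤ δ x' → vertPt (g x') t ∈ T := by
  set U : Set (𝔼 (n + 1) × ℝ) := {p | vertPt (g p.1) p.2 ∈ T} with hU
  have hUo : IsOpen U :=
    hT.preimage (continuous_vertPt.comp ((hg.comp continuous_fst).prodMk continuous_snd))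
  set K : Set (𝔼 (n + 1) × ℝ) := {p | p.2 = 0} with hK
  have hKc : IsClosed K := isClosed_eq continuous_snd continuous_const
  have hKU : K ⊆ U := by
    rintro ⟨x', t⟩ (ht : t = 0)
    show vertPt (g x') t ∈ T
    rw [ht, vertPt_zero]
    exact h0 x'
  obtain ⟨δ, hδ0, hδ⟩ := Metric.exists_contMDiffMap_forall_closedBall_subset
    (𝓘(ℝ, 𝔼 (n + 1) × ℝ)) (n := ⊤) (K := fun _ : Unit => K) (U := fun _ : Unit => U)
    (fun _ => hKc) (fun _ => hUo) (fun _ => hKU) (locallyFinite_of_finite _)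
  refine ⟨fun x' => δ (x', 0), ?_, fun x' => hδ0 _, fun x' t ht0 ht => ?_⟩
  · have hδs : ContDiff ℝ ∞ (⇑δ : 𝔼 (n + 1) × ℝ → ℝ) := contMDiff_iff_contDiff.1 δ.contMDiff
    exact hδs.comp (contDiff_id.prodMk contDiff_const)
  · have hmem : ((x', t) : 𝔼 (n + 1) × ℝ) ∈ Metric.closedBall ((x', (0 : ℝ)) : 𝔼 (n + 1) × ℝ)
        (δ (x', 0)) := by
      rw [Metric.mem_closedBall, Prod.dist_eq, dist_self, Real.dist_eq, sub_zero, abs_of_nonneg ht0,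
        max_eq_right ht0]
      exact ht
    exact hδ () (x', 0) rfl hmem

end Height

/-! ### §4 The half-disc from the chart -/

section HalfDiscChart

variable {n : ℕ} {A : Type u} [TopologicalSpace A] [ChartedSpace (EuclideanHalfSpace (n + 2)) A]
  {b : BoundaryData (𝓡∂ (n + 2)) A (𝓡 (n + 1))}
  (e : OpenPartialHomeomorph A (EuclideanHalfSpace (n + 2))) (f : 𝔼 (n + 1) → b.carrier)
  (δ : 𝔼 (n + 1) → ℝ)

/-- **The lift `Ψ` of the closed half space into the chart target**:
`Ψ (x₀, x') = (δ(x') σ(x₀), g x')`. [folklore] -/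
def chartLift (v : EuclideanHalfSpace (n + 2)) : EuclideanHalfSpace (n + 2) :=
  vertPt (chartFace e f (hsTail v)) (δ (hsTail v) * collarSquash (v.val 0))

/-- **The inverse `Ψ⁻¹`**: `Ψ⁻¹ (w₀, y) = (τ (w₀ / δ (g⁻¹ y)), g⁻¹ y)`. [folklore] -/
def chartUnlift (w : EuclideanHalfSpace (n + 2)) : EuclideanHalfSpace (n + 2) :=
  vertPt (chartFaceInv e f (hsTail w)) (collarUnsquash (w.val 0 / δ (chartFaceInv e f (hsTail w))))

/-- The range of `Ψ`: tails in the range of `g`, heights below `δ/2`. [folklore] -/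
def chartLiftRange : Set (EuclideanHalfSpace (n + 2)) :=
  {w | hsTail w ∈ range (chartFace e f) ∧ w.val 0 < δ (chartFaceInv e f (hsTail w)) / 2}

/-- **The half-disc from the chart**: `k := e.symm ∘ Ψ`. [folklore] -/
def chartHalfDisc (v : EuclideanHalfSpace (n + 2)) : A := e.symm (chartLift e f δ v)

variable {e f δ}

section Algebra

variable (hδ0 : ∀ x', 0 < δ x')
include hδ0

/-- The underlying vector of `Ψ v`. [folklore] -/
theorem val_chartLift (v : EuclideanHalfSpace (n + 2)) :
    (chartLift e f δ v).val =
      BoundaryManifold.consCLE (n + 1) (chartFace e f (hsTail v), δ (hsTail v) * collarSquash (v.val 0)) :=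
  val_vertPt (mul_nonneg (hδ0 _).le (collarSquash_nonneg v.2))

/-- The tail of `Ψ v` is `g (tail v)`. [folklore] -/
theorem hsTail_chartLift (v : EuclideanHalfSpace (n + 2)) :
    hsTail (chartLift e f δ v) = chartFace e f (hsTail v) := by
  rw [hsTail, val_chartLift hδ0, BoundaryManifold.tail_consCLE]

/-- The height of `Ψ v` is `δ (tail v) σ (v₀)`. [folklore] -/
theorem val_chartLift_zero (v : EuclideanHalfSpace (n + 2)) :
    (chartLift e f δ v).val 0 = δ (hsTail v) * collarSquash (v.val 0) := by
  rw [val_chartLift hδ0, BoundaryManifold.consCLE_apply_zero]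

/-- The height of `Ψ v` is below `δ (tail v) / 2`. [folklore] -/
theorem val_chartLift_zero_lt (v : EuclideanHalfSpace (n + 2)) :
    (chartLift e f δ v).val 0 < δ (hsTail v) / 2 := by
  rw [val_chartLift_zero hδ0]
  have h1 := collarSquash_lt_half (v.val 0)
  have h2 := hδ0 (hsTail v)
  nlinarith

omit hδ0 in
/-- On the flat face `Ψ (0, x') = (0, g x')`. [folklore] -/
theorem chartLift_face (x' : 𝔼 (n + 1)) :
    chartLift e f δ (EuclideanHalfSpace.face x') =
      BoundaryManifold.toHalfSpace (n + 1) (chartFace e f x') := by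
  rw [chartLift, hsTail_face, EuclideanHalfSpace.val_face_apply_zero, collarSquash_zero, mul_zero,
    vertPt_zero]

/-- On the range of `Ψ` the height ratio `w₀ / δ (g⁻¹ (tail w))` lies in `[0, 1/2)`. [folklore] -/
theorem div_lt_half_of_mem {w : EuclideanHalfSpace (n + 2)} (hw : w ∈ chartLiftRange e f δ) :
    w.val 0 / δ (chartFaceInv e f (hsTail w)) < 1 / 2 := by
  have hd := hδ0 (chartFaceInv e f (hsTail w))
  rw [div_lt_iff₀ hd]
  linarith [hw.2]

/-- The underlying vector of `Ψ⁻¹ w` on the range of `Ψ`. [folklore] -/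
theorem val_chartUnlift {w : EuclideanHalfSpace (n + 2)} (hw : w ∈ chartLiftRange e f δ) :
    (chartUnlift e f δ w).val = BoundaryManifold.consCLE (n + 1)
      (chartFaceInv e f (hsTail w), collarUnsquash (w.val 0 / δ (chartFaceInv e f (hsTail w)))) := by
  have hd := hδ0 (chartFaceInv e f (hsTail w))
  refine val_vertPt (collarUnsquash_nonneg (div_nonneg w.2 hd.le) ?_)
  rw [div_lt_iff₀ hd]
  linarith [hw.2]

/-- `Ψ` takes values in `e.target` when `δ` bounds vertical segments inside it. [folklore] -/
theorem chartLift_mem_target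
    (hδ : ∀ x' (t : ℝ), 0 ≤ t → t ≤ δ x' → vertPt (chartFace e f x') t ∈ e.target)
    (v : EuclideanHalfSpace (n + 2)) : chartLift e f δ v ∈ e.target := by
  refine hδ _ _ (mul_nonneg (hδ0 _).le (collarSquash_nonneg v.2)) ?_
  have h1 := collarSquash_lt_half (v.val 0)
  have h2 := hδ0 (hsTail v)
  nlinarith

variable [IsManifold (𝓡∂ (n + 2)) ∞ A] (he : e ∈ atlas (EuclideanHalfSpace (n + 2)) A)
  (hsub : ∀ x', b.incl (f x') ∈ e.source)
include he hsub

/-- `Ψ v ∈ Ψ`-range. [folklore] -/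
theorem chartLift_mem (hf : Injective f) (v : EuclideanHalfSpace (n + 2)) :
    chartLift e f δ v ∈ chartLiftRange e f δ := by
  refine ⟨?_, ?_⟩
  · rw [hsTail_chartLift hδ0]; exact mem_range_self _
  · rw [hsTail_chartLift hδ0, chartFaceInv_chartFace he hsub hf]
    exact val_chartLift_zero_lt hδ0 v

/-- `Ψ⁻¹ ∘ Ψ = id`. [folklore] -/
theorem chartUnlift_chartLift (hf : Injective f) (v : EuclideanHalfSpace (n + 2)) :
    chartUnlift e f δ (chartLift e f δ v) = v := by
  apply EuclideanHalfSpace.ext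
  rw [chartUnlift, hsTail_chartLift hδ0, chartFaceInv_chartFace he hsub hf, val_chartLift_zero hδ0,
    mul_div_cancel_left₀ _ (hδ0 _).ne', collarUnsquash_collarSquash, val_vertPt v.2]
  exact BoundaryManifold.consCLE_tail (n + 1) v.val

/-- `Ψ ∘ Ψ⁻¹ = id` on the range of `Ψ`. [folklore] -/
theorem chartLift_chartUnlift (hf : Injective f) {w : EuclideanHalfSpace (n + 2)}
    (hw : w ∈ chartLiftRange e f δ) : chartLift e f δ (chartUnlift e f δ w) = w := by
  obtain ⟨⟨x₁, hx₁⟩, hw2⟩ := hw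
  have hinv : chartFaceInv e f (hsTail w) = x₁ := by rw [← hx₁, chartFaceInv_chartFace he hsub hf]
  have hd := hδ0 x₁
  have hlt : w.val 0 / δ x₁ < 1 / 2 := by
    rw [div_lt_iff₀ hd]; rw [hinv] at hw2; linarith
  have htail : hsTail (chartUnlift e f δ w) = x₁ := by
    rw [hsTail, val_chartUnlift hδ0 ⟨⟨x₁, hx₁⟩, hw2⟩, BoundaryManifold.tail_consCLE, hinv]
  have hzero : (chartUnlift e f δ w).val 0 = collarUnsquash (w.val 0 / δ x₁) := by
    rw [val_chartUnlift hδ0 ⟨⟨x₁, hx₁⟩, hw2⟩, BoundaryManifold.consCLE_apply_zero, hinv]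
  apply EuclideanHalfSpace.ext
  rw [val_chartLift hδ0, htail, hzero, collarSquash_collarUnsquash hlt, hx₁,
    mul_div_cancel₀ _ hd.ne']
  exact BoundaryManifold.consCLE_tail (n + 1) w.val

/-- The range of `Ψ` is `chartLiftRange`. [folklore] -/
theorem range_chartLift (hf : Injective f) : range (chartLift e f δ) = chartLiftRange e f δ :=
  Subset.antisymm (range_subset_iff.2 (chartLift_mem hδ0 he hsub hf)) fun _ hw =>
    ⟨_, chartLift_chartUnlift hδ0 he hsub hf hw⟩

end Algebra

section Main

variable [IsManifold (𝓡∂ (n + 2)) ∞ A] (he : e ∈ atlas (EuclideanHalfSpace (n + 2)) A)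
  (hsub : ∀ x', b.incl (f x') ∈ e.source) (hδ0 : ∀ x', 0 < δ x')
include he hsub hδ0

omit hδ0 in
/-- The range of `Ψ` is open (the tail condition is open, and the height condition is open on
it, `g⁻¹` and `δ` being continuous there). [folklore] -/
theorem isOpen_chartLiftRange (hf : Manifold.IsSmoothEmbedding (𝓡 (n + 1)) (𝓡 (n + 1)) ∞ f)
    (hfo : IsOpen (range f)) (hδc : Continuous δ) : IsOpen (chartLiftRange e f δ) := by
  have hO : IsOpen {w : EuclideanHalfSpace (n + 2) | hsTail w ∈ range (chartFace e f)} :=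
    (isOpen_range_chartFace he hsub hf hfo).preimage continuous_hsTail
  have hF : ContinuousOn (fun w : EuclideanHalfSpace (n + 2) =>
      δ (chartFaceInv e f (hsTail w)) / 2 - w.val 0) {w | hsTail w ∈ range (chartFace e f)} := by
    refine ContinuousOn.sub (ContinuousOn.div_const (hδc.comp_continuousOn
      ((contMDiffOn_chartFaceInv he hsub hf).continuousOn.comp continuous_hsTail.continuousOn
        fun w hw => hw)) _) ?_
    exact ((EuclideanSpace.proj (0 : Fin (n + 2))).continuous.comp continuous_subtype_val).continuousOn
  have hset : chartLiftRange e f δ = {w | hsTail w ∈ range (chartFace e f)} ∩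
      (fun w : EuclideanHalfSpace (n + 2) => δ (chartFaceInv e f (hsTail w)) / 2 - w.val 0) ⁻¹' Ioi 0 := by
    ext w
    simp only [chartLiftRange, mem_setOf_eq, mem_inter_iff, mem_preimage, mem_Ioi, sub_pos]
  rw [hset]
  exact hF.isOpen_inter_preimage hO isOpen_Ioi

/-- **`Ψ` is smooth.** [folklore] -/
theorem contMDiff_chartLift (hf : ContMDiff (𝓡 (n + 1)) (𝓡 (n + 1)) ∞ f) (hδs : ContDiff ℝ ∞ δ) :
    ContMDiff (𝓡∂ (n + 2)) (𝓡∂ (n + 2)) ∞ (chartLift e f δ) := by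
  have hg := contMDiff_chartFace he hsub hf
  have h1 : ContMDiff (𝓡∂ (n + 2)) (𝓡 (n + 1)) ∞ fun v : EuclideanHalfSpace (n + 2) =>
      chartFace e f (hsTail v) := hg.comp contMDiff_hsTail
  have h0 : ContMDiff (𝓡∂ (n + 2)) 𝓘(ℝ, ℝ) ∞ fun v : EuclideanHalfSpace (n + 2) => v.val 0 :=
    contDiff_euclidean_apply_zero.contMDiff.comp (𝓡∂ (n + 2)).contMDiff
  have h2 : ContMDiff (𝓡∂ (n + 2)) 𝓘(ℝ, ℝ) ∞ fun v : EuclideanHalfSpace (n + 2) =>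
      δ (hsTail v) * collarSquash (v.val 0) :=
    (hδs.contMDiff.comp contMDiff_hsTail).mul (contDiff_collarSquash.contMDiff.comp h0)
  have h3 : ContMDiff (𝓡∂ (n + 2)) 𝓘(ℝ, 𝔼 (n + 2)) ∞ fun v : EuclideanHalfSpace (n + 2) =>
      BoundaryManifold.consCLE (n + 1) (chartFace e f (hsTail v), δ (hsTail v) * collarSquash (v.val 0)) :=
    (BoundaryManifold.consCLE (n + 1)).contDiff.contMDiff.comp (h1.prodMk_space h2)
  have h4 : ContMDiff (𝓡∂ (n + 2)) (𝓡∂ (n + 2)) ∞ fun v : EuclideanHalfSpace (n + 2) =>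
      (𝓡∂ (n + 2)).symm (BoundaryManifold.consCLE (n + 1)
        (chartFace e f (hsTail v), δ (hsTail v) * collarSquash (v.val 0))) :=
    (𝓡∂ (n + 2)).contMDiffOn_symm.comp_contMDiff h3 fun v =>
      consCLE_mem_range_modelWithCorners _ (mul_nonneg (hδ0 _).le (collarSquash_nonneg v.2))
  refine h4.congr fun v => ?_
  show vertPt _ _ = _
  rw [vertPt, max_eq_left (mul_nonneg (hδ0 _).le (collarSquash_nonneg v.2))]

/-- **`Ψ⁻¹` is smooth on the range of `Ψ`.** [folklore] -/
theorem contMDiffOn_chartUnlift (hf : Manifold.IsSmoothEmbedding (𝓡 (n + 1)) (𝓡 (n + 1)) ∞ f)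
    (hδs : ContDiff ℝ ∞ δ) :
    ContMDiffOn (𝓡∂ (n + 2)) (𝓡∂ (n + 2)) ∞ (chartUnlift e f δ) (chartLiftRange e f δ) := by
  set S := chartLiftRange e f δ with hS
  have hT : ContMDiffOn (𝓡∂ (n + 2)) (𝓡 (n + 1)) ∞
      (fun w : EuclideanHalfSpace (n + 2) => chartFaceInv e f (hsTail w)) S :=
    (contMDiffOn_chartFaceInv he hsub hf).comp contMDiff_hsTail.contMDiffOn fun w hw => hw.1
  have h0 : ContMDiff (𝓡∂ (n + 2)) 𝓘(ℝ, ℝ) ∞ fun w : EuclideanHalfSpace (n + 2) => w.val 0 :=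
    contDiff_euclidean_apply_zero.contMDiff.comp (𝓡∂ (n + 2)).contMDiff
  have hden : ContMDiffOn (𝓡∂ (n + 2)) 𝓘(ℝ, ℝ) ∞
      (fun w : EuclideanHalfSpace (n + 2) => δ (chartFaceInv e f (hsTail w))) S :=
    hδs.contMDiff.comp_contMDiffOn hT
  have hq : ContMDiffOn (𝓡∂ (n + 2)) 𝓘(ℝ, ℝ) ∞
      (fun w : EuclideanHalfSpace (n + 2) => w.val 0 / δ (chartFaceInv e f (hsTail w))) S :=
    h0.contMDiffOn.div₀ hden fun w _ => (hδ0 _).ne'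
  have hτ : ContMDiffOn (𝓡∂ (n + 2)) 𝓘(ℝ, ℝ) ∞ (fun w : EuclideanHalfSpace (n + 2) =>
      collarUnsquash (w.val 0 / δ (chartFaceInv e f (hsTail w)))) S :=
    contDiffOn_collarUnsquash.contMDiffOn.comp hq fun w hw => div_lt_half_of_mem hδ0 hw
  have h3 : ContMDiffOn (𝓡∂ (n + 2)) 𝓘(ℝ, 𝔼 (n + 2)) ∞ (fun w : EuclideanHalfSpace (n + 2) =>
      BoundaryManifold.consCLE (n + 1) (chartFaceInv e f (hsTail w),
        collarUnsquash (w.val 0 / δ (chartFaceInv e f (hsTail w))))) S :=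
    (BoundaryManifold.consCLE (n + 1)).contDiff.contMDiff.comp_contMDiffOn (hT.prodMk_space hτ)
  have hnn : ∀ w ∈ S, 0 ≤ collarUnsquash (w.val 0 / δ (chartFaceInv e f (hsTail w))) := fun w hw =>
    collarUnsquash_nonneg (div_nonneg w.2 (hδ0 _).le) (div_lt_half_of_mem hδ0 hw)
  have h4 : ContMDiffOn (𝓡∂ (n + 2)) (𝓡∂ (n + 2)) ∞ (fun w : EuclideanHalfSpace (n + 2) =>
      (𝓡∂ (n + 2)).symm (BoundaryManifold.consCLE (n + 1) (chartFaceInv e f (hsTail w),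
        collarUnsquash (w.val 0 / δ (chartFaceInv e f (hsTail w)))))) S :=
    (𝓡∂ (n + 2)).contMDiffOn_symm.comp h3 fun w hw => consCLE_mem_range_modelWithCorners _ (hnn w hw)
  refine h4.congr fun w hw => ?_
  show vertPt _ _ = _
  rw [vertPt, max_eq_left (hnn w hw)]

omit hδ0 in
/-- **The flat face of the half-disc from the chart is `f`**: `k (0, x') = b.incl (f x')`.
[folklore] -/
theorem chartHalfDisc_face (x' : 𝔼 (n + 1)) :
    chartHalfDisc e f δ (EuclideanHalfSpace.face x') = b.incl (f x') := by
  rw [chartHalfDisc, chartLift_face, symm_toHalfSpace_chartFace he hsub]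

/-- **The half-disc from the chart is a smooth embedding of the closed half space with open
range** (given the height function `δ` of §3). [folklore] -/
theorem isSmoothEmbedding_chartHalfDisc
    (hf : Manifold.IsSmoothEmbedding (𝓡 (n + 1)) (𝓡 (n + 1)) ∞ f) (hfo : IsOpen (range f))
    (hδs : ContDiff ℝ ∞ δ)
    (hδ : ∀ x' (t : ℝ), 0 ≤ t → t ≤ δ x' → vertPt (chartFace e f x') t ∈ e.target) :
    Manifold.IsSmoothEmbedding (𝓡∂ (n + 2)) (𝓡∂ (n + 2)) ∞ (chartHalfDisc e f δ) ∧
      IsOpen (range (chartHalfDisc e f δ)) := by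
  have hemax := IsManifold.subset_maximalAtlas (I := 𝓡∂ (n + 2)) (n := ∞) he
  have hfi : Injective f := hf.isEmbedding.injective
  have hmemT : ∀ v, chartLift e f δ v ∈ e.target := chartLift_mem_target hδ0 hδ
  have hΨ : ContMDiff (𝓡∂ (n + 2)) (𝓡∂ (n + 2)) ∞ (chartLift e f δ) :=
    contMDiff_chartLift he hsub hδ0 hf.contMDiff hδs
  have hk_smooth : ContMDiff (𝓡∂ (n + 2)) (𝓡∂ (n + 2)) ∞ (chartHalfDisc e f δ) :=
    (contMDiffOn_symm_of_mem_maximalAtlas hemax).comp_contMDiff hΨ hmemT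
  have hk_inj : Injective (chartHalfDisc e f δ) := fun v w h =>
    (LeftInverse.injective fun v => chartUnlift_chartLift hδ0 he hsub hfi v)
      (e.symm.injOn (hmemT v) (hmemT w) h)
  have hU : ContinuousOn (chartUnlift e f δ) (chartLiftRange e f δ) :=
    (contMDiffOn_chartUnlift he hsub hδ0 hf hδs).continuousOn
  have hRo : IsOpen (chartLiftRange e f δ) := isOpen_chartLiftRange he hsub hf hfo hδs.continuous
  have hk_open : IsOpenMap (chartHalfDisc e f δ) := by
    intro O hO
    have h1 : chartHalfDisc e f δ '' O = e.symm '' (chartLift e f δ '' O) := by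
      rw [image_image]; rfl
    have h2 : chartLift e f δ '' O = chartLiftRange e f δ ∩ chartUnlift e f δ ⁻¹' O := by
      ext w
      constructor
      · rintro ⟨v, hv, rfl⟩
        refine ⟨chartLift_mem hδ0 he hsub hfi v, ?_⟩
        rw [mem_preimage, chartUnlift_chartLift hδ0 he hsub hfi]
        exact hv
      · rintro ⟨hw, hwO⟩
        exact ⟨_, hwO, chartLift_chartUnlift hδ0 he hsub hfi hw⟩
    rw [h1, h2]
    refine e.symm.isOpen_image_of_subset_source (hU.isOpen_inter_preimage hRo hO) ?_
    rintro w ⟨hw, -⟩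
    rw [← range_chartLift hδ0 he hsub hfi] at hw
    obtain ⟨v, rfl⟩ := hw
    exact hmemT v
  have hk : IsOpenEmbedding (chartHalfDisc e f δ) :=
    .of_continuous_injective_isOpenMap hk_smooth.continuous hk_inj hk_open
  refine ⟨?_, hk_open.isOpen_range⟩
  refine isSmoothEmbedding_of_symm_trans_chartAt_mem_maximalAtlas (I := 𝓡∂ (n + 2))
    (I' := 𝓡∂ (n + 2)) hk (Homeomorph.refl _) (ContinuousLinearEquiv.refl ℝ (𝔼 (n + 2)))
    (fun _ => rfl) ?_
  intro _ a
  simp only [chartAt_self_eq, OpenPartialHomeomorph.trans_refl,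
    Homeomorph.refl_toOpenPartialHomeomorph]
  apply OpenPartialHomeomorph.mem_maximalAtlas_of_contMDiffOn
  · rw [OpenPartialHomeomorph.symm_source, hk.toOpenPartialHomeomorph_target]
    have hsub' : range (chartHalfDisc e f δ) ⊆ e.source := by
      rintro _ ⟨v, rfl⟩; exact e.map_target (hmemT v)
    have hcomp : ContMDiffOn (𝓡∂ (n + 2)) (𝓡∂ (n + 2)) ∞ (fun p => chartUnlift e f δ (e p))
        (range (chartHalfDisc e f δ)) := by
      refine (contMDiffOn_chartUnlift he hsub hδ0 hf hδs).comp
        ((contMDiffOn_of_mem_maximalAtlas hemax).mono hsub') ?_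
      rintro _ ⟨v, rfl⟩
      show e (e.symm (chartLift e f δ v)) ∈ chartLiftRange e f δ
      rw [e.right_inv (hmemT v)]
      exact chartLift_mem hδ0 he hsub hfi v
    refine hcomp.congr ?_
    rintro _ ⟨v, rfl⟩
    show (hk.toOpenPartialHomeomorph _).symm (chartHalfDisc e f δ v) =
      chartUnlift e f δ (e (e.symm (chartLift e f δ v)))
    rw [hk.toOpenPartialHomeomorph_left_inv, e.right_inv (hmemT v),
      chartUnlift_chartLift hδ0 he hsub hfi]
  · rw [OpenPartialHomeomorph.symm_symm, OpenPartialHomeomorph.symm_target,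
      hk.toOpenPartialHomeomorph_source, hk.toOpenPartialHomeomorph_apply]
    exact hk_smooth.contMDiffOn

end Main

end HalfDiscChart

/-! ### §5 Half-discs with prescribed face inside a boundary chart -/

/-- **Half-discs with prescribed flat face, for a disc inside a boundary chart.** Let `A` be a
smooth `(n+2)`-manifold with boundary, `b` a boundary datum, `f : ℝⁿ⁺¹ → ∂A` a smooth embedding
with open range, and `e` a chart of the atlas of `A` whose source contains `b.incl (f x')` for
all `x'`. Then there is a smooth embedding `k` of the closed half space `ℝⁿ⁺²₊` into `A` with open
range and flat face `f`: `k (0, x') = b.incl (f x')`. (This is the conclusion of the named fact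
`Literature.Topology.FourManifolds.exists_halfDisc_face_eq` for such `f`; no collar is used.) Hirsch, *Differential Topology*
(1976), §4.6; Kosinski (1993), VI.5. [folklore] -/
theorem exists_halfDisc_face_eq_of_subset_source {n : ℕ} {A : Type u} [TopologicalSpace A]
    [ChartedSpace (EuclideanHalfSpace (n + 2)) A] [IsManifold (𝓡∂ (n + 2)) ∞ A]
    (b : BoundaryData (𝓡∂ (n + 2)) A (𝓡 (n + 1))) {f : 𝔼 (n + 1) → b.carrier}
    (hf : Manifold.IsSmoothEmbedding (𝓡 (n + 1)) (𝓡 (n + 1)) ∞ f) (hfo : IsOpen (range f))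
    {e : OpenPartialHomeomorph A (EuclideanHalfSpace (n + 2))}
    (he : e ∈ atlas (EuclideanHalfSpace (n + 2)) A) (hsub : ∀ x', b.incl (f x') ∈ e.source) :
    ∃ k : EuclideanHalfSpace (n + 2) → A,
      Manifold.IsSmoothEmbedding (𝓡∂ (n + 2)) (𝓡∂ (n + 2)) ∞ k ∧ IsOpen (range k) ∧
        ∀ x', k (EuclideanHalfSpace.face x') = b.incl (f x') := by
  obtain ⟨δ, hδs, hδ0, hδ⟩ := exists_contDiff_pos_vertPt_mem
    (contMDiff_chartFace he hsub hf.contMDiff).continuous e.open_target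
    (toHalfSpace_chartFace_mem_target he hsub)
  obtain ⟨hk, hko⟩ := isSmoothEmbedding_chartHalfDisc he hsub hδ0 hf hfo hδs hδ
  exact ⟨chartHalfDisc e f δ, hk, hko, fun x' => chartHalfDisc_face he hsub x'⟩

/-- **Corollary: half-discs on discs inside the preferred chart at a boundary point.** [folklore] -/
theorem exists_halfDisc_face_eq_of_subset_chartAt {n : ℕ} {A : Type u} [TopologicalSpace A]
    [ChartedSpace (EuclideanHalfSpace (n + 2)) A] [IsManifold (𝓡∂ (n + 2)) ∞ A]
    (b : BoundaryData (𝓡∂ (n + 2)) A (𝓡 (n + 1))) {f : 𝔼 (n + 1) → b.carrier}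
    (hf : Manifold.IsSmoothEmbedding (𝓡 (n + 1)) (𝓡 (n + 1)) ∞ f) (hfo : IsOpen (range f)) (p : A)
    (hsub : ∀ x', b.incl (f x') ∈ (chartAt (EuclideanHalfSpace (n + 2)) p).source) :
    ∃ k : EuclideanHalfSpace (n + 2) → A,
      Manifold.IsSmoothEmbedding (𝓡∂ (n + 2)) (𝓡∂ (n + 2)) ∞ k ∧ IsOpen (range k) ∧
        ∀ x', k (EuclideanHalfSpace.face x') = b.incl (f x') :=
  exists_halfDisc_face_eq_of_subset_source b hf hfo (chart_mem_atlas _ p) hsub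

end Literature.Topology.FourManifolds
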